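import Summits.ResolutionOfSingularities.ResolutionOfSingularities.Theorems.HomologicalConductorStrictDropTowerShape
import Summits.ResolutionOfSingularities.ResolutionOfSingularities.Theorems.HomologicalConductorStrictDropRegularDrop
import Summits.ResolutionOfSingularities.ResolutionOfSingularities.Theorems.HomologicalConductorNoZenoDiscreteDominator
import Summits.ResolutionOfSingularities.ResolutionOfSingularities.Theorems.HomologicalConductorNoZenoCompositeDominator
import HarnessLib

/-!
# Crux `StrictDrop` (stmt-ResolutionOfSingularities-16485): the EXACT fact-free split —
# `StrictDrop` ⟺ (termination of every NOETHERIAN-DOMINATED canonical tower) ∧ (eternal strict drop along every KERNEL tower)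

Route `ResolutionOfSingularities/HomologicalConductor` (cell decomp-res, hand leafhand-res-homologicalconduct-14 g0).
OURS: AI-written bookkeeping over tree theorems, weaker than expert review; nothing here is a statement of the
manuscript under review (Hironaka 2017).  SUPPORT level, counted 0.  Def-free, fact-free, no new named facts.

`StrictDrop` says: at every singular stage `T_m` of every admissible canonical normalised `ca`-tower, some later stage
carries a nonzero annihilator of value strictly below all of `ca(T_m) ∖ 0`.  Along a tower weakly dominated by a NOETHERIAN
valuation ring this is EQUIVALENT to termination (tree: `stub_noetherianCase`, dominance invariance
`CompositeDominator.tower_eq_of_dominates`, and the endpoint calibration `RegularDrop.stub_regular_drop`: a regular stage carries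
`1`); along a KERNEL tower (only non-noetherian weak dominators; no stage is ever regular,
`DiscreteDominator.not_isRegularLocalRing_of_kernel`) it is the bare «eternal strict drop».  Hence

* **`strictDrop_iff_noetherianTermination_and_kernelDrop`** — `StrictDrop` ⟺
  (NT) «every admissible datum whose tower has a noetherian weak dominator reaches a regular stage» ∧
  (KD) «along every admissible KERNEL datum, from every stage `m` some later stage `m' > m` carries a nonzero
  `y ∈ ca(T_(m'))` with `y · x⁻¹ ∉ O` for all nonzero `x ∈ ca(T_m)`»;
* `noetherianTermination_of_strictDrop`, `kernelDrop_of_strictDrop` — the two halves by name.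

(NT) contains the kill test's prime-divisor case (D-s) and is what `NoZenoR`'s vacuous door feeds on
(`NoZeno.Vacuity.noZenoR_of_nonterminating_of_isNoetherianRing`); (KD) is the part of `StrictDrop` that the companion crux
`NoZenoR` consumes (`DiscreteDominator.noZenoR_iff_noKernelDatum`: under `StrictDrop` no kernel datum exists at all, so
given `NoZenoR`, (KD) is vacuous and `StrictDrop ⟺ (NT)`, cf. `forall_terminates_iff_strictDrop_and_noZenoR`).  No crux, kill
test or summit statement is proved; resolution in char p is NOT proved.
-/

noncomputable section

-- single-problem summit: the doubled namespace component `ResolutionOfSingularities` is forced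
set_option linter.dupNamespace false

open Summit.ResolutionOfSingularities.ResolutionOfSingularities.Theses.HomologicalConductor (StrictDrop NoZenoR)

namespace Summit.ResolutionOfSingularities.ResolutionOfSingularities.Theorems.StrictDrop.KernelDoor

open Summit.ResolutionOfSingularities.ResolutionOfSingularities.Theorems
open Summit.ResolutionOfSingularities.ResolutionOfSingularities.Theorems.NoZeno
open Summit.ResolutionOfSingularities.ResolutionOfSingularities.Theorems.NoZeno.Birth

/-- **(NT) from `StrictDrop`**: a tower weakly dominated by a noetherian valuation ring `O'` reaches a regular stage —
the `O'`-tower is the `O`-tower (`CompositeDominator.tower_eq_of_dominates`) and `StrictDrop` terminates it at the datum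
`(k, K, O', A)` (`stub_noetherianCase`). [this work; composition of tree results] -/
theorem noetherianTermination_of_strictDrop (hD : StrictDrop) (p : ℕ) (hp : p.Prime) (k K : Type) [Field k]
    [CharP k p] [Field K] [Algebra k K] (O : ValuationSubring K) (A : Subalgebra k K)
    (hk : ∀ c : k, algebraMap k K c ∈ O) (hA : A.FG) (hfr : IsFractionRing ↥A K)
    (hAO : A.toSubring ≤ O.toSubring)
    (hdom : ∃ O' : ValuationSubring K, IsNoetherianRing ↥O' ∧
      ∀ m : ℕ, ∀ s ∈ tower O A m, s ∈ O' ∧ (s⁻¹ ∈ O' → s⁻¹ ∈ O)) :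
    ∃ m : ℕ, IsRegularLocalRing ↥(tower O A m) := by
  obtain ⟨O', hN, hdom⟩ := hdom
  have hT : ∀ m : ℕ, tower O' A m = tower O A m :=
    CompositeDominator.tower_eq_of_dominates O A O' hk hA hfr hAO hdom
  have hk' : ∀ c : k, algebraMap k K c ∈ O' := CompositeDominator.algebraMap_mem_of_dominates O A O' hdom
  have hAO' : A.toSubring ≤ O'.toSubring := CompositeDominator.le_of_dominates O A O' hdom
  obtain ⟨m, hm⟩ := stub_noetherianCase hD p hp k K O' A hk' hA hfr hAO' hN
  exact ⟨m, by rw [← hT m]; exact hm⟩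

/-- **(KD) from `StrictDrop`**: along a kernel tower (only non-noetherian weak dominators) every stage is singular
(`DiscreteDominator.not_isRegularLocalRing_of_kernel`), so `StrictDrop` drops from every stage. [this work; composition of tree results] -/
theorem kernelDrop_of_strictDrop (hD : StrictDrop) (p : ℕ) (hp : p.Prime) (k K : Type) [Field k]
    [CharP k p] [Field K] [Algebra k K] (O : ValuationSubring K) (A : Subalgebra k K)
    (hk : ∀ c : k, algebraMap k K c ∈ O) (hA : A.FG) (hfr : IsFractionRing ↥A K)
    (hAO : A.toSubring ≤ O.toSubring)
    (hker : ∀ O' : ValuationSubring K,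
      (∀ m : ℕ, ∀ s ∈ tower O A m, s ∈ O' ∧ (s⁻¹ ∈ O' → s⁻¹ ∈ O)) → ¬ IsNoetherianRing ↥O')
    (m : ℕ) : ∃ m' : ℕ, m < m' ∧ ∃ y ∈ ca (tower O A m'), y ≠ 0 ∧
      ∀ x ∈ ca (tower O A m), x ≠ 0 → y * x⁻¹ ∉ O :=
  hD p hp k K O A hk hA hfr hAO m (DiscreteDominator.not_isRegularLocalRing_of_kernel O A hk hfr hAO hker m)

/-- **`StrictDrop` ⟺ (NT) ∧ (KD)** (fact-free; the exact split of the crux by dominator type).  `→`: the two halves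
above.  `←`: at a singular stage `T_m` of a datum, either the tower is a kernel tower — then (KD) — or some noetherian
valuation ring weakly dominates it — then (NT) gives a regular stage `T_M`, regular stages persist
(`tower_succ_eq_self_of_isRegularLocalRing`), and at the regular stage `T_(max M (m+1))` the endpoint calibration
(`RegularDrop.stub_regular_drop` over `TowerShape.stub_towerShape`) supplies `y = 1`. [this work; composition of tree results] -/
theorem strictDrop_iff_noetherianTermination_and_kernelDrop : StrictDrop ↔
    ((∀ p : ℕ, p.Prime → ∀ (k K : Type) [Field k] [CharP k p] [Field K] [Algebra k K] (O : ValuationSubring K)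
        (A : Subalgebra k K), (∀ c : k, algebraMap k K c ∈ O) → A.FG → IsFractionRing ↥A K →
        A.toSubring ≤ O.toSubring →
        (∃ O' : ValuationSubring K, IsNoetherianRing ↥O' ∧
          ∀ m : ℕ, ∀ s ∈ tower O A m, s ∈ O' ∧ (s⁻¹ ∈ O' → s⁻¹ ∈ O)) →
        ∃ m : ℕ, IsRegularLocalRing ↥(tower O A m)) ∧
      (∀ p : ℕ, p.Prime → ∀ (k K : Type) [Field k] [CharP k p] [Field K] [Algebra k K] (O : ValuationSubring K)
        (A : Subalgebra k K), (∀ c : k, algebraMap k K c ∈ O) → A.FG → IsFractionRing ↥A K →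
        A.toSubring ≤ O.toSubring →
        (∀ O' : ValuationSubring K,
          (∀ m : ℕ, ∀ s ∈ tower O A m, s ∈ O' ∧ (s⁻¹ ∈ O' → s⁻¹ ∈ O)) → ¬ IsNoetherianRing ↥O') →
        ∀ m : ℕ, ∃ m' : ℕ, m < m' ∧ ∃ y ∈ ca (tower O A m'), y ≠ 0 ∧
          ∀ x ∈ ca (tower O A m), x ≠ 0 → y * x⁻¹ ∉ O)) := by
  constructor
  · intro hD
    exact ⟨fun p hp k K _ _ _ _ O A hk hA hfr hAO hdom =>
        noetherianTermination_of_strictDrop hD p hp k K O A hk hA hfr hAO hdom,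
      fun p hp k K _ _ _ _ O A hk hA hfr hAO hker m =>
        kernelDrop_of_strictDrop hD p hp k K O A hk hA hfr hAO hker m⟩
  · rintro ⟨hNT, hKD⟩
    intro p hp k K _ _ _ _ O A hk hA hfr hAO ca' loc' chart' nrm' tower' m hm
    by_cases hker : ∀ O' : ValuationSubring K,
        (∀ n : ℕ, ∀ s ∈ tower O A n, s ∈ O' ∧ (s⁻¹ ∈ O' → s⁻¹ ∈ O)) → ¬ IsNoetherianRing ↥O'
    · -- kernel tower: (KD)
      exact hKD p hp k K O A hk hA hfr hAO hker m
    · -- a noetherian weak dominator: (NT) gives a regular stage, which persists; endpoint calibration at a later one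
      push Not at hker
      obtain ⟨O', hdom, hN⟩ := hker
      obtain ⟨M, hregM⟩ : ∃ M : ℕ, IsRegularLocalRing ↥(tower O A M) :=
        hNT p hp k K O A hk hA hfr hAO ⟨O', hN, hdom⟩
      have hpersist : ∀ j : ℕ, IsRegularLocalRing ↥(tower O A (M + j)) := by
        intro j
        induction j with
        | zero => exact hregM
        | succ j ih =>
          have hstat : tower O A (M + j + 1) = tower O A (M + j) :=
            tower_succ_eq_self_of_isRegularLocalRing O A hk hfr hAO (M + j) ih
          rw [← Nat.add_assoc, hstat]
          exact ih
      obtain ⟨j, hj⟩ := Nat.exists_eq_add_of_le (le_max_left M (m + 1))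
      have hregn : IsRegularLocalRing ↥(tower O A (M + j)) := hpersist j
      have hmn : m < M + j := by
        rw [← hj]
        exact Nat.lt_of_lt_of_le (Nat.lt_succ_self m) (le_max_right M (m + 1))
      have hshape := StrictDrop.Birth.TowerShape.stub_towerShape p hp k K O A hk hA hfr hAO
      obtain ⟨y, hy, hy0, hval⟩ :=
        StrictDrop.Birth.RegularDrop.stub_regular_drop p hp k K O A hk hA hfr hAO hshape m (M + j) hm hregn
      exact ⟨M + j, hmn, y, hy, hy0, hval⟩

/-- **`StrictDrop` ⟸ (NT) + «no kernel datum»** (fact-free conditional door): if every noetherian-dominated tower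
terminates and NO admissible datum is a kernel datum (every tower has a noetherian weak dominator — the conclusion of
`NoZenoR` under `StrictDrop`, `DiscreteDominator.noZenoR_iff_noKernelDatum`), then `StrictDrop` holds, (KD) being vacuous.
Together with `forall_terminates_iff_strictDrop_and_noZenoR` this says: BOTH open cruxes of the route ⟺ (NT) ∧ «no kernel
datum». [this work; composition of tree results] -/
theorem strictDrop_of_noetherianTermination_of_noKernelDatum
    (hNT : ∀ p : ℕ, p.Prime → ∀ (k K : Type) [Field k] [CharP k p] [Field K] [Algebra k K] (O : ValuationSubring K)
        (A : Subalgebra k K), (∀ c : k, algebraMap k K c ∈ O) → A.FG → IsFractionRing ↥A K →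
        A.toSubring ≤ O.toSubring →
        (∃ O' : ValuationSubring K, IsNoetherianRing ↥O' ∧
          ∀ m : ℕ, ∀ s ∈ tower O A m, s ∈ O' ∧ (s⁻¹ ∈ O' → s⁻¹ ∈ O)) →
        ∃ m : ℕ, IsRegularLocalRing ↥(tower O A m))
    (hNoK : ∀ p : ℕ, p.Prime → ∀ (k K : Type) [Field k] [CharP k p] [Field K] [Algebra k K] (O : ValuationSubring K)
        (A : Subalgebra k K), (∀ c : k, algebraMap k K c ∈ O) → A.FG → IsFractionRing ↥A K →
        A.toSubring ≤ O.toSubring →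
        ¬ (∀ O' : ValuationSubring K,
          (∀ m : ℕ, ∀ s ∈ tower O A m, s ∈ O' ∧ (s⁻¹ ∈ O' → s⁻¹ ∈ O)) → ¬ IsNoetherianRing ↥O')) :
    StrictDrop :=
  strictDrop_iff_noetherianTermination_and_kernelDrop.mpr
    ⟨hNT, fun p hp k K _ _ _ _ O A hk hA hfr hAO hker _ => absurd hker (hNoK p hp k K O A hk hA hfr hAO)⟩

end Summit.ResolutionOfSingularities.ResolutionOfSingularities.Theorems.StrictDrop.KernelDoor

end
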